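import Mathlib
import Literature.MathematicalPhysics.QuantumManyBody.PeriodicBoseGas
import Literature.MathematicalPhysics.QuantumManyBody.WeightedCorrector

/-!
# Sketch — crux-ideate stmt-AtomisticToContinuum-9481 (DensityResponse), ideator k = 1, round 1

First lemmas of the idea cards `momentum-law-hydrostatic-corrector` and
`source-family-curvature-duhamel`, stated over existing declarations only (`WeightedCorrector.lean`:
`hMinusOneSqW`, `dirichletFormW`, `IsPeriodicTest`, `IsWeakCorrector`, `pderiv`; `PeriodicBoseGas.lean`:
`PeriodicTrialState`, `Config`, `Space`, `cellN`). Nothing here is proved (`sorry`); the file elaborates.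

Notation. `k = 2πn/L`, `|k|² = (2π/L)² ∑ᵢ nᵢ²` (`ksq`), `ρ_c(X) = ∑ⱼ cos(k·xⱼ)` (`densityCos`, one half of
the crux's observable `∑ⱼ 2cos(k·xⱼ)`), `Q(X) = ∑ⱼ sin(k·xⱼ) k̂·∇ⱼ log Θ²(X)` (`forceWave`). `Θ` is a positive
translation-invariant periodic trial state (in the cards: the torus minimiser `Ψ₀`, or a member `Ψ_t` of the
source family); the weight of `hMinusOneSqW` / `dirichletFormW` is the real function `X ↦ ‖Θ.ψ X‖` whose square
integrates to `1` on the cell. In the ground-state representation `E(FΘ) − E₀ = 𝓔_Θ(F) = dirichletFormW`, and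
`hMinusOneSqW L ‖Θ‖ ρ_c = m₋₁(ρ_c) = χ_{ρ_cρ_c}/2` is the `s → 0` content of DensityResponse.
-/

noncomputable section

open MeasureTheory
open scoped ENNReal

namespace Summit.AtomisticToContinuum.BoseEinsteinCondensation.Cruxes.DensityResponse.SketchIdeator1

open Literature.MathematicalPhysics.QuantumManyBody.BoseGas

variable {N : ℕ} {L : ℝ}

/-- `|k|² = (2π/L)² ∑ᵢ nᵢ²` (Euclidean; the crux's sup-norm `k∞²` differs by a factor `≤ 3`). -/
def ksq (L : ℝ) (n : Fin 3 → ℤ) : ℝ :=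
  (2 * Real.pi / L) ^ 2 * ∑ i, (n i : ℝ) ^ 2

/-- `|k|`. -/
def knorm (L : ℝ) (n : Fin 3 → ℤ) : ℝ :=
  Real.sqrt (ksq L n)

/-- The phase `k · xⱼ`. -/
def phase (L : ℝ) (n : Fin 3 → ℤ) (X : Config N) (j : Fin N) : ℝ :=
  2 * Real.pi / L * ∑ i, (n i : ℝ) * X j i

/-- The density wave `ρ_c(X) = ∑ⱼ cos(k·xⱼ)` (half the crux's perturbation `∑ⱼ 2cos(k·xⱼ)`). -/
def densityCos (N : ℕ) (L : ℝ) (n : Fin 3 → ℤ) (X : Config N) : ℝ :=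
  ∑ j : Fin N, Real.cos (phase L n X j)

/-- The real weight `X ↦ ‖Θ(X)‖`. -/
def weight (Θ : PeriodicTrialState N L) (X : Config N) : ℝ :=
  ‖Θ.ψ X‖

/-- Longitudinal derivative `k̂ · ∇ⱼ φ` of a real function along the wave direction, particle `j`. -/
def longDeriv (L : ℝ) (n : Fin 3 → ℤ) (j : Fin N) (φ : Config N → ℝ) (X : Config N) : ℝ :=
  ∑ i : Fin 3, (2 * Real.pi / L * (n i : ℝ)) / knorm L n * pderiv j i φ X

/-- FORCE WAVE `Q(X) = ∑ⱼ sin(k·xⱼ) k̂·∇ⱼ log Θ²(X) = ∑ⱼ sin(k·xⱼ) · 2 (k̂·∇ⱼ‖Θ‖)/‖Θ‖`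
(junk where `Θ = 0`; it only ever appears against `Θ²`). Exact identity (weak, on the torus):
`−L_Θ ρ_c = |k|² ρ_c + |k| Q`, `L_Θ = Δ + ∇log Θ²·∇`. -/
def forceWave (Θ : PeriodicTrialState N L) (n : Fin 3 → ℤ) (X : Config N) : ℝ :=
  ∑ j : Fin N, Real.sin (phase L n X j) * (2 * longDeriv L n j (weight Θ) X / weight Θ X)

/-! ### Card `momentum-law-hydrostatic-corrector` -/

/-- PARTIAL-CORRECTOR (triangle) INEQUALITY for the Kipnis–Varadhan `H₋₁` norm: if an observable `g`
decomposes weakly as `g = (−L_F) G + r` for a periodic test function `G` (an *approximate corrector*),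
then `‖g‖₋₁ ≤ √𝓔_F(G) + ‖r‖₋₁`. Proof (S/M-sized, from the sup formula `hMinusOneSqW` and
`hMinusOneSqW_le_ofReal_iff`): for a test `φ`, `2∫gφF² − 𝓔(φ) = 2𝓔(G,φ) + 2∫rφF² − 𝓔(φ)
≤ 2√𝓔(G)√𝓔(φ) + 2√R√𝓔(φ) − 𝓔(φ) ≤ (√𝓔(G) + √R)²`. -/
theorem partialCorrector_bound (L : ℝ) (F g r G : Config N → ℝ) (hF : Continuous F)
    (hG : IsPeriodicTest L G)
    (hdec : ∀ φ : Config N → ℝ, IsPeriodicTest L φ →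
      ∫ X in cellN N L, g X * φ X * F X ^ 2 =
        dirichletFormW L F G φ + ∫ X in cellN N L, r X * φ X * F X ^ 2)
    (R : ℝ) (hR : 0 ≤ R) (hr : hMinusOneSqW L F r ≤ ENNReal.ofReal R) :
    hMinusOneSqW L F g ≤
      ENNReal.ofReal ((Real.sqrt (dirichletFormW L F G G) + Real.sqrt R) ^ 2) := by
  sorry

/-- MOMENTUM-LAW CORRECTOR BOUND (level 2 of the conservation-law ladder). Hypothesis `hΠ` is the
ground-state form of momentum continuity `i[H, J] = k·Π`: the function `|k|ρ_c + Q` (the ground-state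
transform of the longitudinal current `J_k Θ`) is a weak corrector of `|k|·Π`, where for a `C³` minimiser
`Π = |k|²ρ_c + 2|k|Q + 4T_c + (2/|k|)W_s` is the LONGITUDINAL STRESS WAVE (kinetic stress wave
`T_c = ∑ⱼ cos(k·xⱼ)(−∂_L²Θ)/Θ`, virial wave `W_s = ∑_{i<j}[sin k·xⱼ − sin k·xᵢ] ∂_L v(xᵢ−xⱼ)`; here `Π` is
abstract). For every stiffness `κ > 0` (hydrodynamic subtraction `Π = κρ_c + Π̃`):
`‖ρ_c‖₋₁ ≤ √𝓔(|k|ρ_c + Q)/(|k|κ) + ‖Π − κρ_c‖₋₁/κ`, and `𝓔(|k|ρ_c + Q) = m₃(ρ_c)/|k|²` is Puff's explicit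
third moment. Immediate from `partialCorrector_bound` with `G = (|k|ρ_c + Q)/(|k|κ)`, `r = −(Π − κρ_c)/κ`. -/
theorem momentumLaw_corrector_bound (hL : 0 < L) (n : Fin 3 → ℤ) (hn : n ≠ 0)
    (Θ : PeriodicTrialState N L) (hpos : ∀ X, Θ.ψ X ≠ 0)
    (hG : IsPeriodicTest L (fun X => knorm L n * densityCos N L n X + forceWave Θ n X))
    (Pst : Config N → ℝ)
    (hPst : IsWeakCorrector L (weight Θ) (fun X => knorm L n * Pst X)
      (fun X => knorm L n * densityCos N L n X + forceWave Θ n X))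
    (κ R : ℝ) (hκ : 0 < κ) (hR : 0 ≤ R)
    (hrem : hMinusOneSqW L (weight Θ) (fun X => Pst X - κ * densityCos N L n X) ≤ ENNReal.ofReal R) :
    hMinusOneSqW L (weight Θ) (densityCos N L n) ≤
      ENNReal.ofReal ((Real.sqrt (dirichletFormW L (weight Θ)
          (fun X => knorm L n * densityCos N L n X + forceWave Θ n X)
          (fun X => knorm L n * densityCos N L n X + forceWave Θ n X)) / (knorm L n * κ) +
        Real.sqrt R / κ) ^ 2) := by
  sorry

/-- HYDROSTATIC PAIRING (the f-sum rule in hydrostatic dress): for a positive translation-invariant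
periodic `Θ`, `∫ (ρ_c + Q/|k|) ρ_c Θ² = N/2` — one integration by parts per particle on the torus
(`∫ Q ρ_c Θ² = −|k| ∫ (ρ_c² − ∑ⱼ sin²(k·xⱼ)) Θ²`) and `∫ cos(2k·xⱼ) Θ² = 0` (uniform one-body density,
`2n ≠ 0`). In `H₋₁` language: `⟨Π, ρ_c⟩₋₁ = ⟨ρ_c + Q/|k|, ρ_c⟩_{Θ²} = N/2` for the stress wave `Π` of
`momentumLaw_corrector_bound`, whatever the interaction. -/
theorem hydrostatic_pairing (hL : 0 < L) (n : Fin 3 → ℤ) (hn : n ≠ 0)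
    (Θ : PeriodicTrialState N L) (hreal : ∀ X, Θ.ψ X = (‖Θ.ψ X‖ : ℂ)) (hpos : ∀ X, Θ.ψ X ≠ 0)
    (htrans : ∀ (X : Config N) (s : Space), Θ.ψ (fun j => X j + s) = Θ.ψ X) :
    ∫ X in cellN N L,
        (densityCos N L n X + forceWave Θ n X / knorm L n) * densityCos N L n X * weight Θ X ^ 2 =
      N / 2 := by
  sorry

/-- HYDROSTATIC RESPONSE BOUND (the `m₃`-free form of the lever). With the stress wave `Π` of
`momentumLaw_corrector_bound` and ANY stiffness `κ > 0`: `κ·m₋₁(ρ_c) = N/2 − ⟨Π − κρ_c, ρ_c⟩₋₁`, hence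
`m₋₁(ρ_c) ≤ N/κ + ‖Π − κρ_c‖²₋₁/κ²`. So the `s → 0` content of DensityResponse on the infrared window,
`m₋₁(ρ_c) ≤ C N/(k² + ρa)`, FOLLOWS from an `H₋₁` bound OF THE SAME ORDER, `‖Π − κρ_c‖²₋₁ ≤ C' N (k² + ρa)`
with `κ = κ₀(k² + ρa)`, on the NON-CONSERVED stress fluctuation `Π̃ = Π − κρ_c` (no `1/gap`, no third
moment, no energy asymptotics). Proof from the corrector identity `IsWeakCorrector.hMinusOneSqW_eq`
(`m₋₁ = 𝓔(δ,δ) = ∫ρ_c δ Θ²` for a weak corrector `δ` of `ρ_c`), `hΠ` tested against `δ`,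
`hydrostatic_pairing`, and `IsWeakCorrector.sq_integral_le` for `|∫ Π̃ δ Θ²| ≤ √R √m₋₁`. -/
theorem hydrostatic_response_bound (hL : 0 < L) (n : Fin 3 → ℤ) (hn : n ≠ 0)
    (Θ : PeriodicTrialState N L) (hreal : ∀ X, Θ.ψ X = (‖Θ.ψ X‖ : ℂ)) (hpos : ∀ X, Θ.ψ X ≠ 0)
    (htrans : ∀ (X : Config N) (s : Space), Θ.ψ (fun j => X j + s) = Θ.ψ X)
    (hG : IsPeriodicTest L (fun X => knorm L n * densityCos N L n X + forceWave Θ n X))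
    (Pst : Config N → ℝ)
    (hPst : IsWeakCorrector L (weight Θ) (fun X => knorm L n * Pst X)
      (fun X => knorm L n * densityCos N L n X + forceWave Θ n X))
    (δ : Config N → ℝ) (hδ : IsWeakCorrector L (weight Θ) (densityCos N L n) δ)
    (κ R : ℝ) (hκ : 0 < κ) (hR : 0 ≤ R)
    (hrem : hMinusOneSqW L (weight Θ) (fun X => Pst X - κ * densityCos N L n X) ≤ ENNReal.ofReal R) :
    hMinusOneSqW L (weight Θ) (densityCos N L n) ≤ ENNReal.ofReal (N / κ + R / κ ^ 2) := by
  sorry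

/-! ### Card `source-family-curvature-duhamel` -/

/-- CHORD FROM UNIFORM CURVATURE (Duhamel along the source family) — the real-analysis spine of the
transfer `DensityResponse ⇐ uniform static response of the ground states Ψ_t of H − tV_k, 0 ≤ t ≤ s₀`:
if `e(s) := E₀(H − sV) − E₀` is `C²` with `e(0) = 0`, `e'(0) = 0` (even in `s`), `e'' ≥ −2A` on `[0, s₀]`
(curvature = `−χ(t) = −4m₋₁(t)` by second-order perturbation theory at `t`), and `e(s) ≥ −B s` for all
`s ≥ 0` (the trivial operator bound `‖sV‖ ≤ 2sN`), then `e(s) ≥ −max(A, B/s₀)·s²` for every `s ≥ 0` — the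
crux's chord with `C N/(k²+ρa) = max(A, B/s₀)`, `s₀ = θ(k² + ρa)`, `B = 2N`, `A = sup_t 2m₋₁(t)`. -/
theorem chord_of_uniform_curvature (e : ℝ → ℝ) (A B s₀ : ℝ) (hA : 0 ≤ A) (hB : 0 ≤ B)
    (hs₀ : 0 < s₀) (he : ContDiff ℝ 2 e) (h0 : e 0 = 0) (h1 : deriv e 0 = 0)
    (hcurv : ∀ t ∈ Set.Icc (0 : ℝ) s₀, -(2 * A) ≤ deriv (deriv e) t)
    (hlip : ∀ s : ℝ, 0 ≤ s → -(B * s) ≤ e s) :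
    ∀ s : ℝ, 0 ≤ s → -(max A (B / s₀) * s ^ 2) ≤ e s := by
  sorry

end Summit.AtomisticToContinuum.BoseEinsteinCondensation.Cruxes.DensityResponse.SketchIdeator1

end
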